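import Mathlib
import HarnessLib
import Summits.HubbardSuperconductivity.HubbardSuperconductivity.Theorems.KLProgrammePerturbedFermiCurveHigherDerivs

/-!
# Route `KLProgramme` — crux C4a, named input (i) «Jacobian jets», orders 0–2 (the SHARP orders): the angular jets of the polar Jacobian
# `J = u / ∂_t e` of a `C⁴` polar curve in terms of the band sizes `E₁, E₂, E₃`, the radius tower `U₀, R₁, R₂` and the transversality `ρ₀`

Cell `gate-hubbard-kl`, lane hubbard-kl-c4a-1 (g2); helper for the engine-flow child `KLRegimeEngineV17F2` (stmt-HubbardSuperconductivity-20437),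
stub (C) `stub_twoLeg_curvature` (memo HOME/hubbard-kl-c4a-1/C4A-PLAN.md §11 (i), §12.2/12.3′: the tube tadpole-jet theorem takes
`hJjet : ‖∂_ϑⁱ levelChartJac μ K (ρ, ·)‖ ≤ G i`; orders 0–2 must be SHARP — they meet the one tight line of the (C) table, k = 2 at n ∈ {0,1}).

ABSTRACT SETTING (as in `…PerturbedFermiCurveHigherDerivs` §4): a `C⁴` function `e` on `Fin 2 → ℝ` and a `C⁴` radius `u : ℝ → ℝ`; along the polar
curve `γ ϑ = u ϑ • dir ϑ` put `D ϑ := De(γ ϑ)[dir ϑ]` (the RADIAL derivative; for the frame band `D = ∂_t e_K`, so `∂_μ u = 1/D` and the chart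
Jacobian of …C4aTubeTadpole is `levelChartJac = u · D⁻¹`).  With pointwise sizes `‖De‖ ≤ E₁`, `‖D²e‖ ≤ E₂`, `‖D³e‖ ≤ E₃` on the curve, `|u| ≤ U₀`,
`|u′| ≤ R₁`, `|u″| ≤ R₂`, `D ≥ ρ₀ > 0` (all uniform in the angle):

* §1 `hasDerivAt_radialSlope` (`D′ = D²e(γ)[γ′, d] + De(γ)[d⊥]`), `abs_radialSlope_deriv_le` (`|D′| ≤ Δ₁ := E₂(R₁+U₀) + E₁`);
  `hasDerivAt_radialSlope_deriv`, `abs_radialSlope_deriv_two_le` (`|D″| ≤ Δ₂ := E₃(R₁+U₀)² + E₂(R₂+2R₁+U₀) + 2E₂(R₁+U₀) + E₁`);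
* §2 the Jacobian `J = u/D`: `abs_polarJac_le` (`≤ U₀/ρ₀`), `abs_deriv_polarJac_le` (`≤ R₁/ρ₀ + U₀Δ₁/ρ₀²`),
  `abs_deriv_two_polarJac_le` (`≤ R₂/ρ₀ + 2R₁Δ₁/ρ₀² + U₀Δ₂/ρ₀² + 2U₀Δ₁²/ρ₀³`), and `deriv`/`iteratedDeriv` bookkeeping.

The frame instantiation (`e = ε₀ + δ_K` at level `μ + ρ`, `E₁ = 4 + 2A`, `E₂ = 4 + 4A`, `E₃ = 4 + 8A₃`, `ρ₀ = Dt_min − 2A`, `U₀ = π√2`, the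
tree's `R₁, R₂`, and `levelChartJac = u/D`) is the next file.  Orders 3, 4 (`E₄`, `E₅` — the in-piece Bernstein order) follow the same pattern.
Pure calculus; nothing is asserted about the Hubbard model.  References: BGM 2006 §2.4 Lemma 2.1 (2.40) [cite: BenfattoGiulianiMastropietro2006].
-/

noncomputable section

namespace Summit.HubbardSuperconductivity.HubbardSuperconductivity.Theorems.C4a

set_option linter.dupNamespace false -- summit = problem name (single-conjunct summit), D-0017
set_option maxSynthPendingDepth 3 -- nested operator-norm instances (third Fréchet derivatives)

open Real Set
open Literature.MathematicalPhysics.QuantumLattice Literature.MathematicalPhysics.QuantumLattice.BandSectorCounting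
open Summit.HubbardSuperconductivity.HubbardSuperconductivity.Theorems.PerturbedFermiCurve

section Polar

variable {e : (Fin 2 → ℝ) → ℝ} (he : ContDiff ℝ 4 e) {u : ℝ → ℝ} (hu : ContDiff ℝ 4 u)
include he hu

/-! ## §1 The radial slope `D(ϑ) = De(u ϑ • dir ϑ)[dir ϑ]` and its first two angular derivatives -/

/-- **`D′`**: `(d/dϑ) De(γ ϑ)[dir ϑ] = D²e(γ ϑ)[γ′ ϑ][dir ϑ] + De(γ ϑ)[dir(ϑ + π/2)]`, `γ′ = u′•d + u•d⊥`. -/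
theorem hasDerivAt_radialSlope (ϑ : ℝ) :
    HasDerivAt (fun t : ℝ => fderiv ℝ e (u t • dir t) (dir t))
      (fderiv ℝ (fderiv ℝ e) (u ϑ • dir ϑ) (deriv u ϑ • dir ϑ + u ϑ • dir (ϑ + π / 2)) (dir ϑ) +
        fderiv ℝ e (u ϑ • dir ϑ) (dir (ϑ + π / 2))) ϑ := by
  have h1 : ContDiff ℝ 3 (fderiv ℝ e) := he.fderiv_right (by norm_num)
  have hc : HasDerivAt (fun t : ℝ => fderiv ℝ e (u t • dir t))
      (fderiv ℝ (fderiv ℝ e) (u ϑ • dir ϑ) (deriv u ϑ • dir ϑ + u ϑ • dir (ϑ + π / 2))) ϑ := by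
    have hd : DifferentiableAt ℝ (fderiv ℝ e) (u ϑ • dir ϑ) := (h1.differentiable (by norm_num)) _
    exact hd.hasFDerivAt.comp_hasDerivAt ϑ (hasDerivAt_polar_zero hu ϑ)
  exact hc.clm_apply (PerturbedFermiCurve.hasDerivAt_dir ϑ)

omit he hu in
/-- **`|D′| ≤ Δ₁ = E₂(R₁+U₀) + E₁`**. -/
theorem abs_radialSlope_deriv_le {ϑ E₁ E₂ U₀ R₁ : ℝ} (hE₁ : ‖fderiv ℝ e (u ϑ • dir ϑ)‖ ≤ E₁)
    (hE₂ : ‖fderiv ℝ (fderiv ℝ e) (u ϑ • dir ϑ)‖ ≤ E₂) (hU₀ : |u ϑ| ≤ U₀) (hR₁ : |deriv u ϑ| ≤ R₁) :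
    |fderiv ℝ (fderiv ℝ e) (u ϑ • dir ϑ) (deriv u ϑ • dir ϑ + u ϑ • dir (ϑ + π / 2)) (dir ϑ) +
        fderiv ℝ e (u ϑ • dir ϑ) (dir (ϑ + π / 2))| ≤ E₂ * (R₁ + U₀) + E₁ := by
  have hE₁0 : 0 ≤ E₁ := (norm_nonneg _).trans hE₁
  have hE₂0 : 0 ≤ E₂ := (norm_nonneg _).trans hE₂
  have hv : ‖deriv u ϑ • dir ϑ + u ϑ • dir (ϑ + π / 2)‖ ≤ R₁ + U₀ :=
    (norm_frame_comb_le _ _ ϑ).trans (add_le_add hR₁ hU₀)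
  refine (abs_add_le _ _).trans (add_le_add ?_ ?_)
  · rw [← Real.norm_eq_abs]
    calc ‖fderiv ℝ (fderiv ℝ e) (u ϑ • dir ϑ) (deriv u ϑ • dir ϑ + u ϑ • dir (ϑ + π / 2)) (dir ϑ)‖
        ≤ ‖fderiv ℝ (fderiv ℝ e) (u ϑ • dir ϑ) (deriv u ϑ • dir ϑ + u ϑ • dir (ϑ + π / 2))‖ * ‖dir ϑ‖ :=
          ContinuousLinearMap.le_opNorm _ _
      _ ≤ ‖fderiv ℝ (fderiv ℝ e) (u ϑ • dir ϑ)‖ * ‖deriv u ϑ • dir ϑ + u ϑ • dir (ϑ + π / 2)‖ * 1 :=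
          mul_le_mul (ContinuousLinearMap.le_opNorm _ _) (norm_dir_le_one ϑ) (norm_nonneg _)
            (mul_nonneg (norm_nonneg _) (norm_nonneg _))
      _ ≤ E₂ * (R₁ + U₀) * 1 := by
          refine mul_le_mul_of_nonneg_right (mul_le_mul hE₂ hv (norm_nonneg _) hE₂0) zero_le_one
      _ = E₂ * (R₁ + U₀) := mul_one _
  · rw [← Real.norm_eq_abs]
    calc ‖fderiv ℝ e (u ϑ • dir ϑ) (dir (ϑ + π / 2))‖ ≤ ‖fderiv ℝ e (u ϑ • dir ϑ)‖ * ‖dir (ϑ + π / 2)‖ :=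
          ContinuousLinearMap.le_opNorm _ _
      _ ≤ E₁ * 1 := mul_le_mul hE₁ (norm_dir_le_one _) (norm_nonneg _) hE₁0
      _ = E₁ := mul_one _

/-- **`D″`**: the derivative of `D′` — `D³e(γ)[γ′,γ′,d] + D²e(γ)[γ″,d] + 2·D²e(γ)[γ′,d⊥] − De(γ)[d]`, `γ″ = (u″−u)•d + 2u′•d⊥`. -/
theorem hasDerivAt_radialSlope_deriv (ϑ : ℝ) :
    HasDerivAt (fun t : ℝ =>
        fderiv ℝ (fderiv ℝ e) (u t • dir t) (deriv u t • dir t + u t • dir (t + π / 2)) (dir t) +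
          fderiv ℝ e (u t • dir t) (dir (t + π / 2)))
      ((fderiv ℝ (fderiv ℝ (fderiv ℝ e)) (u ϑ • dir ϑ) (deriv u ϑ • dir ϑ + u ϑ • dir (ϑ + π / 2))
            (deriv u ϑ • dir ϑ + u ϑ • dir (ϑ + π / 2)) +
          fderiv ℝ (fderiv ℝ e) (u ϑ • dir ϑ) ((deriv (deriv u) ϑ - u ϑ) • dir ϑ + (2 * deriv u ϑ) • dir (ϑ + π / 2))) (dir ϑ) +
        fderiv ℝ (fderiv ℝ e) (u ϑ • dir ϑ) (deriv u ϑ • dir ϑ + u ϑ • dir (ϑ + π / 2)) (dir (ϑ + π / 2)) +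
        (fderiv ℝ (fderiv ℝ e) (u ϑ • dir ϑ) (deriv u ϑ • dir ϑ + u ϑ • dir (ϑ + π / 2)) (dir (ϑ + π / 2)) +
          fderiv ℝ e (u ϑ • dir ϑ) (-dir ϑ))) ϑ := by
  have h1 : ContDiff ℝ 3 (fderiv ℝ e) := he.fderiv_right (by norm_num)
  have h2 : ContDiff ℝ 2 (fderiv ℝ (fderiv ℝ e)) := h1.fderiv_right (by norm_num)
  -- c₂ t := D²e(γ t), c₁ t := De(γ t)
  have hc2 : HasDerivAt (fun t : ℝ => fderiv ℝ (fderiv ℝ e) (u t • dir t))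
      (fderiv ℝ (fderiv ℝ (fderiv ℝ e)) (u ϑ • dir ϑ) (deriv u ϑ • dir ϑ + u ϑ • dir (ϑ + π / 2))) ϑ := by
    have hd : DifferentiableAt ℝ (fderiv ℝ (fderiv ℝ e)) (u ϑ • dir ϑ) := (h2.differentiable (by norm_num)) _
    exact hd.hasFDerivAt.comp_hasDerivAt ϑ (hasDerivAt_polar_zero hu ϑ)
  have hc1 : HasDerivAt (fun t : ℝ => fderiv ℝ e (u t • dir t))
      (fderiv ℝ (fderiv ℝ e) (u ϑ • dir ϑ) (deriv u ϑ • dir ϑ + u ϑ • dir (ϑ + π / 2))) ϑ := by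
    have hd : DifferentiableAt ℝ (fderiv ℝ e) (u ϑ • dir ϑ) := (h1.differentiable (by norm_num)) _
    exact hd.hasFDerivAt.comp_hasDerivAt ϑ (hasDerivAt_polar_zero hu ϑ)
  -- term 1: (c₂ t (γ′ t)) (dir t)
  have hA : HasDerivAt (fun t : ℝ => fderiv ℝ (fderiv ℝ e) (u t • dir t) (deriv u t • dir t + u t • dir (t + π / 2)))
      (fderiv ℝ (fderiv ℝ (fderiv ℝ e)) (u ϑ • dir ϑ) (deriv u ϑ • dir ϑ + u ϑ • dir (ϑ + π / 2))
          (deriv u ϑ • dir ϑ + u ϑ • dir (ϑ + π / 2)) +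
        fderiv ℝ (fderiv ℝ e) (u ϑ • dir ϑ) ((deriv (deriv u) ϑ - u ϑ) • dir ϑ + (2 * deriv u ϑ) • dir (ϑ + π / 2))) ϑ :=
    hc2.clm_apply (hasDerivAt_polar_one hu ϑ)
  have hT1 := hA.clm_apply (PerturbedFermiCurve.hasDerivAt_dir ϑ)
  -- term 2: c₁ t (dir (t + π/2))
  have hT2 := hc1.clm_apply (hasDerivAt_dir_add_pi_div_two ϑ)
  exact hT1.add hT2

omit he hu in
/-- **`|D″| ≤ Δ₂ = E₃(R₁+U₀)² + E₂(R₂+2R₁+U₀) + 2E₂(R₁+U₀) + E₁`**. -/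
theorem abs_radialSlope_deriv_two_le {ϑ E₁ E₂ E₃ U₀ R₁ R₂ : ℝ} (hE₁ : ‖fderiv ℝ e (u ϑ • dir ϑ)‖ ≤ E₁)
    (hE₂ : ‖fderiv ℝ (fderiv ℝ e) (u ϑ • dir ϑ)‖ ≤ E₂) (hE₃ : ‖fderiv ℝ (fderiv ℝ (fderiv ℝ e)) (u ϑ • dir ϑ)‖ ≤ E₃)
    (hU₀ : |u ϑ| ≤ U₀) (hR₁ : |deriv u ϑ| ≤ R₁) (hR₂ : |deriv (deriv u) ϑ| ≤ R₂) :
    |(fderiv ℝ (fderiv ℝ (fderiv ℝ e)) (u ϑ • dir ϑ) (deriv u ϑ • dir ϑ + u ϑ • dir (ϑ + π / 2))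
            (deriv u ϑ • dir ϑ + u ϑ • dir (ϑ + π / 2)) +
          fderiv ℝ (fderiv ℝ e) (u ϑ • dir ϑ) ((deriv (deriv u) ϑ - u ϑ) • dir ϑ + (2 * deriv u ϑ) • dir (ϑ + π / 2))) (dir ϑ) +
        fderiv ℝ (fderiv ℝ e) (u ϑ • dir ϑ) (deriv u ϑ • dir ϑ + u ϑ • dir (ϑ + π / 2)) (dir (ϑ + π / 2)) +
        (fderiv ℝ (fderiv ℝ e) (u ϑ • dir ϑ) (deriv u ϑ • dir ϑ + u ϑ • dir (ϑ + π / 2)) (dir (ϑ + π / 2)) +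
          fderiv ℝ e (u ϑ • dir ϑ) (-dir ϑ))| ≤
      E₃ * (R₁ + U₀) ^ 2 + E₂ * (R₂ + 2 * R₁ + U₀) + 2 * (E₂ * (R₁ + U₀)) + E₁ := by
  have hE₁0 : 0 ≤ E₁ := (norm_nonneg _).trans hE₁
  have hE₂0 : 0 ≤ E₂ := (norm_nonneg _).trans hE₂
  have hE₃0 : 0 ≤ E₃ := (norm_nonneg _).trans hE₃
  set v₁ := deriv u ϑ • dir ϑ + u ϑ • dir (ϑ + π / 2) with hv₁
  set v₂ := (deriv (deriv u) ϑ - u ϑ) • dir ϑ + (2 * deriv u ϑ) • dir (ϑ + π / 2) with hv₂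
  have hv1 : ‖v₁‖ ≤ R₁ + U₀ := (norm_frame_comb_le _ _ ϑ).trans (add_le_add hR₁ hU₀)
  have hK0 : 0 ≤ R₁ + U₀ := (norm_nonneg _).trans hv1
  have hv2 : ‖v₂‖ ≤ R₂ + 2 * R₁ + U₀ := by
    refine (norm_frame_comb_le _ _ ϑ).trans ?_
    have h1 : |deriv (deriv u) ϑ - u ϑ| ≤ R₂ + U₀ := (abs_sub _ _).trans (add_le_add hR₂ hU₀)
    have h2 : |2 * deriv u ϑ| ≤ 2 * R₁ := by rw [abs_mul, abs_two]; linarith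
    linarith
  have hd0 := norm_dir_le_one ϑ
  have hd1 := norm_dir_le_one (ϑ + π / 2)
  have hdn : ‖-dir ϑ‖ ≤ 1 := by rw [norm_neg]; exact hd0
  -- generic operator-norm estimates
  have op1 : ∀ (A : (Fin 2 → ℝ) →L[ℝ] ℝ) (w : Fin 2 → ℝ) {EA nw : ℝ}, ‖A‖ ≤ EA → ‖w‖ ≤ nw → |A w| ≤ EA * nw := by
    intro A w EA nw hA hw
    rw [← Real.norm_eq_abs]
    exact (A.le_opNorm w).trans (mul_le_mul hA hw (norm_nonneg _) ((norm_nonneg _).trans hA))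
  have op2 : ∀ (A : (Fin 2 → ℝ) →L[ℝ] (Fin 2 → ℝ) →L[ℝ] ℝ) (v w : Fin 2 → ℝ) {EA nv nw : ℝ},
      ‖A‖ ≤ EA → ‖v‖ ≤ nv → ‖w‖ ≤ nw → |A v w| ≤ EA * nv * nw := by
    intro A v w EA nv nw hA hv hw
    rw [← Real.norm_eq_abs]
    have hnv : 0 ≤ nv := (norm_nonneg _).trans hv
    calc ‖A v w‖ ≤ ‖A v‖ * ‖w‖ := (A v).le_opNorm w
      _ ≤ ‖A‖ * ‖v‖ * ‖w‖ := mul_le_mul_of_nonneg_right (A.le_opNorm v) (norm_nonneg _)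
      _ ≤ EA * nv * nw := mul_le_mul (mul_le_mul hA hv (norm_nonneg _) ((norm_nonneg _).trans hA)) hw (norm_nonneg _)
          (mul_nonneg ((norm_nonneg _).trans hA) hnv)
  have op3 : ∀ (A : (Fin 2 → ℝ) →L[ℝ] (Fin 2 → ℝ) →L[ℝ] (Fin 2 → ℝ) →L[ℝ] ℝ) (v w x : Fin 2 → ℝ) {EA nv nw nx : ℝ},
      ‖A‖ ≤ EA → ‖v‖ ≤ nv → ‖w‖ ≤ nw → ‖x‖ ≤ nx → |A v w x| ≤ EA * nv * nw * nx := by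
    intro A v w x EA nv nw nx hA hv hw hx
    have hnw : 0 ≤ nw := (norm_nonneg _).trans hw
    have h := op2 (A v) w x ((A.le_opNorm v).trans (mul_le_mul hA hv (norm_nonneg _) ((norm_nonneg _).trans hA))) hw hx
    simpa [mul_assoc] using h
  have t1 := op3 (fderiv ℝ (fderiv ℝ (fderiv ℝ e)) (u ϑ • dir ϑ)) v₁ v₁ (dir ϑ) hE₃ hv1 hv1 hd0
  have t2 := op2 (fderiv ℝ (fderiv ℝ e) (u ϑ • dir ϑ)) v₂ (dir ϑ) hE₂ hv2 hd0
  have t3 := op2 (fderiv ℝ (fderiv ℝ e) (u ϑ • dir ϑ)) v₁ (dir (ϑ + π / 2)) hE₂ hv1 hd1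
  have t4 := op1 (fderiv ℝ e (u ϑ • dir ϑ)) (-dir ϑ) hE₁ hdn
  have hsum1 : |(fderiv ℝ (fderiv ℝ (fderiv ℝ e)) (u ϑ • dir ϑ) v₁ v₁ + fderiv ℝ (fderiv ℝ e) (u ϑ • dir ϑ) v₂) (dir ϑ)| ≤
      E₃ * (R₁ + U₀) * (R₁ + U₀) * 1 + E₂ * (R₂ + 2 * R₁ + U₀) * 1 := by
    rw [show (fderiv ℝ (fderiv ℝ (fderiv ℝ e)) (u ϑ • dir ϑ) v₁ v₁ + fderiv ℝ (fderiv ℝ e) (u ϑ • dir ϑ) v₂) (dir ϑ) =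
        fderiv ℝ (fderiv ℝ (fderiv ℝ e)) (u ϑ • dir ϑ) v₁ v₁ (dir ϑ) + fderiv ℝ (fderiv ℝ e) (u ϑ • dir ϑ) v₂ (dir ϑ) from rfl]
    exact (abs_add_le _ _).trans (add_le_add t1 t2)
  calc _ ≤ |(fderiv ℝ (fderiv ℝ (fderiv ℝ e)) (u ϑ • dir ϑ) v₁ v₁ + fderiv ℝ (fderiv ℝ e) (u ϑ • dir ϑ) v₂) (dir ϑ)| +
        |fderiv ℝ (fderiv ℝ e) (u ϑ • dir ϑ) v₁ (dir (ϑ + π / 2))| +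
        |fderiv ℝ (fderiv ℝ e) (u ϑ • dir ϑ) v₁ (dir (ϑ + π / 2)) + fderiv ℝ e (u ϑ • dir ϑ) (-dir ϑ)| :=
          (abs_add_le _ _).trans (add_le_add (abs_add_le _ _) le_rfl)
    _ ≤ (E₃ * (R₁ + U₀) * (R₁ + U₀) * 1 + E₂ * (R₂ + 2 * R₁ + U₀) * 1) + E₂ * (R₁ + U₀) * 1 +
        (E₂ * (R₁ + U₀) * 1 + E₁ * 1) :=
          add_le_add (add_le_add hsum1 t3) ((abs_add_le _ _).trans (add_le_add t3 t4))
    _ = E₃ * (R₁ + U₀) ^ 2 + E₂ * (R₂ + 2 * R₁ + U₀) + 2 * (E₂ * (R₁ + U₀)) + E₁ := by ring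


/-! ## §2 The polar Jacobian `J = u / D` and its first two angular derivatives -/

omit he hu in
/-- **Order 0**: `|u/D| ≤ U₀/ρ₀`. -/
theorem abs_polarJac_le {ϑ ρ₀ U₀ : ℝ} (hρ0 : 0 < ρ₀) (hρ : ρ₀ ≤ fderiv ℝ e (u ϑ • dir ϑ) (dir ϑ)) (hU₀ : |u ϑ| ≤ U₀) :
    |u ϑ / fderiv ℝ e (u ϑ • dir ϑ) (dir ϑ)| ≤ U₀ / ρ₀ := by
  rw [abs_div]
  exact div_le_div₀ ((abs_nonneg _).trans hU₀) hU₀ hρ0 (hρ.trans (le_abs_self _))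

/-- **The first derivative of `J = u/D`** (quotient rule with `D′` of §1). -/
theorem hasDerivAt_polarJac {ϑ : ℝ} (hD : fderiv ℝ e (u ϑ • dir ϑ) (dir ϑ) ≠ 0) :
    HasDerivAt (fun t : ℝ => u t / fderiv ℝ e (u t • dir t) (dir t))
      ((deriv u ϑ * fderiv ℝ e (u ϑ • dir ϑ) (dir ϑ) -
          u ϑ * (fderiv ℝ (fderiv ℝ e) (u ϑ • dir ϑ) (deriv u ϑ • dir ϑ + u ϑ • dir (ϑ + π / 2)) (dir ϑ) +
            fderiv ℝ e (u ϑ • dir ϑ) (dir (ϑ + π / 2)))) /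
        fderiv ℝ e (u ϑ • dir ϑ) (dir ϑ) ^ 2) ϑ :=
  ((hasDerivAt_tower_of_contDiff_four hu ϑ).1).div (hasDerivAt_radialSlope he hu ϑ) hD

/-- **Order 1**: `|J′| ≤ R₁/ρ₀ + U₀·Δ₁/ρ₀²`, `Δ₁ = E₂(R₁+U₀) + E₁`. -/
theorem abs_deriv_polarJac_le {ρ₀ E₁ E₂ U₀ R₁ : ℝ} (hρ0 : 0 < ρ₀) (hρ : ∀ ϑ, ρ₀ ≤ fderiv ℝ e (u ϑ • dir ϑ) (dir ϑ))
    (hE₁ : ∀ ϑ, ‖fderiv ℝ e (u ϑ • dir ϑ)‖ ≤ E₁) (hE₂ : ∀ ϑ, ‖fderiv ℝ (fderiv ℝ e) (u ϑ • dir ϑ)‖ ≤ E₂)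
    (hU₀ : ∀ ϑ, |u ϑ| ≤ U₀) (hR₁ : ∀ ϑ, |deriv u ϑ| ≤ R₁) (ϑ : ℝ) :
    |deriv (fun t : ℝ => u t / fderiv ℝ e (u t • dir t) (dir t)) ϑ| ≤ R₁ / ρ₀ + U₀ * (E₂ * (R₁ + U₀) + E₁) / ρ₀ ^ 2 := by
  set D : ℝ := fderiv ℝ e (u ϑ • dir ϑ) (dir ϑ) with hDdef
  set D₁ : ℝ := fderiv ℝ (fderiv ℝ e) (u ϑ • dir ϑ) (deriv u ϑ • dir ϑ + u ϑ • dir (ϑ + π / 2)) (dir ϑ) +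
    fderiv ℝ e (u ϑ • dir ϑ) (dir (ϑ + π / 2)) with hD₁def
  have hDge : ρ₀ ≤ D := hρ ϑ
  have hDpos : 0 < D := hρ0.trans_le hDge
  have hDabs : ρ₀ ≤ |D| := hDge.trans (le_abs_self _)
  rw [(hasDerivAt_polarJac he hu hDpos.ne').deriv]
  have hsplit : (deriv u ϑ * D - u ϑ * D₁) / D ^ 2 = deriv u ϑ / D - u ϑ * D₁ / D ^ 2 := by
    field_simp
  rw [hsplit]
  have hΔ₁ : |D₁| ≤ E₂ * (R₁ + U₀) + E₁ := abs_radialSlope_deriv_le (hE₁ ϑ) (hE₂ ϑ) (hU₀ ϑ) (hR₁ ϑ)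
  have hU0 : 0 ≤ U₀ := (abs_nonneg _).trans (hU₀ ϑ)
  refine (abs_sub _ _).trans (add_le_add ?_ ?_)
  · rw [abs_div]
    exact div_le_div₀ ((abs_nonneg _).trans (hR₁ ϑ)) (hR₁ ϑ) hρ0 hDabs
  · rw [abs_div, abs_mul, abs_pow]
    refine div_le_div₀ (mul_nonneg hU0 ((abs_nonneg _).trans hΔ₁)) (mul_le_mul (hU₀ ϑ) hΔ₁ (abs_nonneg _) hU0)
      (pow_pos hρ0 2) (pow_le_pow_left₀ hρ0.le hDabs 2)

/-- `deriv J` as a function (the quotient-rule expression), when `D` never vanishes. -/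
theorem deriv_polarJac_eq (hD : ∀ ϑ, fderiv ℝ e (u ϑ • dir ϑ) (dir ϑ) ≠ 0) :
    deriv (fun t : ℝ => u t / fderiv ℝ e (u t • dir t) (dir t)) = fun ϑ =>
      (deriv u ϑ * fderiv ℝ e (u ϑ • dir ϑ) (dir ϑ) -
          u ϑ * (fderiv ℝ (fderiv ℝ e) (u ϑ • dir ϑ) (deriv u ϑ • dir ϑ + u ϑ • dir (ϑ + π / 2)) (dir ϑ) +
            fderiv ℝ e (u ϑ • dir ϑ) (dir (ϑ + π / 2)))) /
        fderiv ℝ e (u ϑ • dir ϑ) (dir ϑ) ^ 2 :=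
  funext fun ϑ => (hasDerivAt_polarJac he hu (hD ϑ)).deriv

/-- **The second derivative of `J = u/D`** exists: `HasDerivAt (deriv J) J₂ ϑ` with the quotient-rule value. -/
theorem hasDerivAt_deriv_polarJac (hD : ∀ ϑ, fderiv ℝ e (u ϑ • dir ϑ) (dir ϑ) ≠ 0) (ϑ : ℝ) :
    HasDerivAt (deriv (fun t : ℝ => u t / fderiv ℝ e (u t • dir t) (dir t)))
      ((((deriv (deriv u) ϑ * fderiv ℝ e (u ϑ • dir ϑ) (dir ϑ) +
              deriv u ϑ * (fderiv ℝ (fderiv ℝ e) (u ϑ • dir ϑ) (deriv u ϑ • dir ϑ + u ϑ • dir (ϑ + π / 2)) (dir ϑ) +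
                fderiv ℝ e (u ϑ • dir ϑ) (dir (ϑ + π / 2)))) -
            (deriv u ϑ * (fderiv ℝ (fderiv ℝ e) (u ϑ • dir ϑ) (deriv u ϑ • dir ϑ + u ϑ • dir (ϑ + π / 2)) (dir ϑ) +
                fderiv ℝ e (u ϑ • dir ϑ) (dir (ϑ + π / 2))) +
              u ϑ * ((fderiv ℝ (fderiv ℝ (fderiv ℝ e)) (u ϑ • dir ϑ) (deriv u ϑ • dir ϑ + u ϑ • dir (ϑ + π / 2))
                    (deriv u ϑ • dir ϑ + u ϑ • dir (ϑ + π / 2)) +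
                  fderiv ℝ (fderiv ℝ e) (u ϑ • dir ϑ) ((deriv (deriv u) ϑ - u ϑ) • dir ϑ + (2 * deriv u ϑ) • dir (ϑ + π / 2)))
                  (dir ϑ) +
                fderiv ℝ (fderiv ℝ e) (u ϑ • dir ϑ) (deriv u ϑ • dir ϑ + u ϑ • dir (ϑ + π / 2)) (dir (ϑ + π / 2)) +
                (fderiv ℝ (fderiv ℝ e) (u ϑ • dir ϑ) (deriv u ϑ • dir ϑ + u ϑ • dir (ϑ + π / 2)) (dir (ϑ + π / 2)) +
                  fderiv ℝ e (u ϑ • dir ϑ) (-dir ϑ))))) *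
            fderiv ℝ e (u ϑ • dir ϑ) (dir ϑ) ^ 2 -
          (deriv u ϑ * fderiv ℝ e (u ϑ • dir ϑ) (dir ϑ) -
              u ϑ * (fderiv ℝ (fderiv ℝ e) (u ϑ • dir ϑ) (deriv u ϑ • dir ϑ + u ϑ • dir (ϑ + π / 2)) (dir ϑ) +
                fderiv ℝ e (u ϑ • dir ϑ) (dir (ϑ + π / 2)))) *
            (2 * fderiv ℝ e (u ϑ • dir ϑ) (dir ϑ) *
              (fderiv ℝ (fderiv ℝ e) (u ϑ • dir ϑ) (deriv u ϑ • dir ϑ + u ϑ • dir (ϑ + π / 2)) (dir ϑ) +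
                fderiv ℝ e (u ϑ • dir ϑ) (dir (ϑ + π / 2))))) /
        (fderiv ℝ e (u ϑ • dir ϑ) (dir ϑ) ^ 2) ^ 2) ϑ := by
  rw [deriv_polarJac_eq he hu hD]
  obtain ⟨h0, h1, -, -⟩ := hasDerivAt_tower_of_contDiff_four hu ϑ
  have hDd := hasDerivAt_radialSlope he hu ϑ
  have hD₁d := hasDerivAt_radialSlope_deriv he hu ϑ
  have hnum := (h1.mul hDd).sub (h0.mul hD₁d)
  have hden : HasDerivAt (fun t : ℝ => fderiv ℝ e (u t • dir t) (dir t) ^ 2)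
      (2 * fderiv ℝ e (u ϑ • dir ϑ) (dir ϑ) *
        (fderiv ℝ (fderiv ℝ e) (u ϑ • dir ϑ) (deriv u ϑ • dir ϑ + u ϑ • dir (ϑ + π / 2)) (dir ϑ) +
          fderiv ℝ e (u ϑ • dir ϑ) (dir (ϑ + π / 2)))) ϑ := by
    have h := hDd.mul hDd
    have hfun : (fun t : ℝ => fderiv ℝ e (u t • dir t) (dir t) ^ 2) =
        fun t : ℝ => fderiv ℝ e (u t • dir t) (dir t) * fderiv ℝ e (u t • dir t) (dir t) := funext fun t => sq _
    rw [hfun]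
    refine h.congr_deriv ?_
    ring
  exact hnum.div hden (pow_ne_zero 2 (hD ϑ))

/-- **Order 2**: `|J″| ≤ R₂/ρ₀ + 2R₁Δ₁/ρ₀² + U₀Δ₂/ρ₀² + 2U₀Δ₁²/ρ₀³`. -/
theorem abs_deriv_two_polarJac_le {ρ₀ E₁ E₂ E₃ U₀ R₁ R₂ : ℝ} (hρ0 : 0 < ρ₀)
    (hρ : ∀ ϑ, ρ₀ ≤ fderiv ℝ e (u ϑ • dir ϑ) (dir ϑ))
    (hE₁ : ∀ ϑ, ‖fderiv ℝ e (u ϑ • dir ϑ)‖ ≤ E₁) (hE₂ : ∀ ϑ, ‖fderiv ℝ (fderiv ℝ e) (u ϑ • dir ϑ)‖ ≤ E₂)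
    (hE₃ : ∀ ϑ, ‖fderiv ℝ (fderiv ℝ (fderiv ℝ e)) (u ϑ • dir ϑ)‖ ≤ E₃)
    (hU₀ : ∀ ϑ, |u ϑ| ≤ U₀) (hR₁ : ∀ ϑ, |deriv u ϑ| ≤ R₁) (hR₂ : ∀ ϑ, |deriv (deriv u) ϑ| ≤ R₂) (ϑ : ℝ) :
    |deriv (deriv (fun t : ℝ => u t / fderiv ℝ e (u t • dir t) (dir t))) ϑ| ≤
      R₂ / ρ₀ + 2 * (R₁ * (E₂ * (R₁ + U₀) + E₁)) / ρ₀ ^ 2 +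
        U₀ * (E₃ * (R₁ + U₀) ^ 2 + E₂ * (R₂ + 2 * R₁ + U₀) + 2 * (E₂ * (R₁ + U₀)) + E₁) / ρ₀ ^ 2 +
        2 * (U₀ * (E₂ * (R₁ + U₀) + E₁) ^ 2) / ρ₀ ^ 3 := by
  have hD : ∀ ϑ, fderiv ℝ e (u ϑ • dir ϑ) (dir ϑ) ≠ 0 := fun ϑ => (hρ0.trans_le (hρ ϑ)).ne'
  rw [(hasDerivAt_deriv_polarJac he hu hD ϑ).deriv]
  set D : ℝ := fderiv ℝ e (u ϑ • dir ϑ) (dir ϑ) with hDdef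
  set D₁ : ℝ := fderiv ℝ (fderiv ℝ e) (u ϑ • dir ϑ) (deriv u ϑ • dir ϑ + u ϑ • dir (ϑ + π / 2)) (dir ϑ) +
    fderiv ℝ e (u ϑ • dir ϑ) (dir (ϑ + π / 2)) with hD₁def
  set D₂ : ℝ := (fderiv ℝ (fderiv ℝ (fderiv ℝ e)) (u ϑ • dir ϑ) (deriv u ϑ • dir ϑ + u ϑ • dir (ϑ + π / 2))
        (deriv u ϑ • dir ϑ + u ϑ • dir (ϑ + π / 2)) +
      fderiv ℝ (fderiv ℝ e) (u ϑ • dir ϑ) ((deriv (deriv u) ϑ - u ϑ) • dir ϑ + (2 * deriv u ϑ) • dir (ϑ + π / 2))) (dir ϑ) +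
    fderiv ℝ (fderiv ℝ e) (u ϑ • dir ϑ) (deriv u ϑ • dir ϑ + u ϑ • dir (ϑ + π / 2)) (dir (ϑ + π / 2)) +
    (fderiv ℝ (fderiv ℝ e) (u ϑ • dir ϑ) (deriv u ϑ • dir ϑ + u ϑ • dir (ϑ + π / 2)) (dir (ϑ + π / 2)) +
      fderiv ℝ e (u ϑ • dir ϑ) (-dir ϑ)) with hD₂def
  set u0 := u ϑ
  set u1 := deriv u ϑ
  set u2 := deriv (deriv u) ϑ
  have hDge : ρ₀ ≤ D := hρ ϑ
  have hDpos : 0 < D := hρ0.trans_le hDge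
  have hDabs : ρ₀ ≤ |D| := hDge.trans (le_abs_self _)
  have hsplit : (((u2 * D + u1 * D₁) - (u1 * D₁ + u0 * D₂)) * D ^ 2 - (u1 * D - u0 * D₁) * (2 * D * D₁)) / (D ^ 2) ^ 2 =
      u2 / D - u0 * D₂ / D ^ 2 - 2 * (u1 * D₁) / D ^ 2 + 2 * (u0 * D₁ ^ 2) / D ^ 3 := by
    field_simp
    ring
  rw [hsplit]
  have hΔ₁ : |D₁| ≤ E₂ * (R₁ + U₀) + E₁ := abs_radialSlope_deriv_le (hE₁ ϑ) (hE₂ ϑ) (hU₀ ϑ) (hR₁ ϑ)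
  have hΔ₂ : |D₂| ≤ E₃ * (R₁ + U₀) ^ 2 + E₂ * (R₂ + 2 * R₁ + U₀) + 2 * (E₂ * (R₁ + U₀)) + E₁ :=
    abs_radialSlope_deriv_two_le (hE₁ ϑ) (hE₂ ϑ) (hE₃ ϑ) (hU₀ ϑ) (hR₁ ϑ) (hR₂ ϑ)
  have hU0 : 0 ≤ U₀ := (abs_nonneg _).trans (hU₀ ϑ)
  have hR10 : 0 ≤ R₁ := (abs_nonneg _).trans (hR₁ ϑ)
  have hΔ10 : 0 ≤ E₂ * (R₁ + U₀) + E₁ := (abs_nonneg _).trans hΔ₁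
  have hΔ20 : 0 ≤ E₃ * (R₁ + U₀) ^ 2 + E₂ * (R₂ + 2 * R₁ + U₀) + 2 * (E₂ * (R₁ + U₀)) + E₁ := (abs_nonneg _).trans hΔ₂
  -- term by term
  have t1 : |u2 / D| ≤ R₂ / ρ₀ := by
    rw [abs_div]; exact div_le_div₀ ((abs_nonneg _).trans (hR₂ ϑ)) (hR₂ ϑ) hρ0 hDabs
  have t2 : |u0 * D₂ / D ^ 2| ≤ U₀ * (E₃ * (R₁ + U₀) ^ 2 + E₂ * (R₂ + 2 * R₁ + U₀) + 2 * (E₂ * (R₁ + U₀)) + E₁) / ρ₀ ^ 2 := by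
    rw [abs_div, abs_mul, abs_pow]
    exact div_le_div₀ (mul_nonneg hU0 hΔ20) (mul_le_mul (hU₀ ϑ) hΔ₂ (abs_nonneg _) hU0) (pow_pos hρ0 2)
      (pow_le_pow_left₀ hρ0.le hDabs 2)
  have t3 : |2 * (u1 * D₁) / D ^ 2| ≤ 2 * (R₁ * (E₂ * (R₁ + U₀) + E₁)) / ρ₀ ^ 2 := by
    rw [abs_div, abs_mul, abs_mul, abs_two, abs_pow]
    exact div_le_div₀ (by positivity) (mul_le_mul_of_nonneg_left (mul_le_mul (hR₁ ϑ) hΔ₁ (abs_nonneg _) hR10) (by norm_num))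
      (pow_pos hρ0 2) (pow_le_pow_left₀ hρ0.le hDabs 2)
  have t4 : |2 * (u0 * D₁ ^ 2) / D ^ 3| ≤ 2 * (U₀ * (E₂ * (R₁ + U₀) + E₁) ^ 2) / ρ₀ ^ 3 := by
    rw [abs_div, abs_mul, abs_mul, abs_two, abs_pow, abs_pow]
    have hsq : |D₁| ^ 2 ≤ (E₂ * (R₁ + U₀) + E₁) ^ 2 := pow_le_pow_left₀ (abs_nonneg _) hΔ₁ 2
    exact div_le_div₀ (by positivity) (mul_le_mul_of_nonneg_left (mul_le_mul (hU₀ ϑ) hsq (by positivity) hU0) (by norm_num))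
      (pow_pos hρ0 3) (pow_le_pow_left₀ hρ0.le hDabs 3)
  calc |u2 / D - u0 * D₂ / D ^ 2 - 2 * (u1 * D₁) / D ^ 2 + 2 * (u0 * D₁ ^ 2) / D ^ 3|
      ≤ |u2 / D| + |u0 * D₂ / D ^ 2| + |2 * (u1 * D₁) / D ^ 2| + |2 * (u0 * D₁ ^ 2) / D ^ 3| := by
        refine (abs_add_le _ _).trans (add_le_add ?_ le_rfl)
        refine (abs_sub _ _).trans (add_le_add ?_ le_rfl)
        exact abs_sub _ _
    _ ≤ R₂ / ρ₀ + U₀ * (E₃ * (R₁ + U₀) ^ 2 + E₂ * (R₂ + 2 * R₁ + U₀) + 2 * (E₂ * (R₁ + U₀)) + E₁) / ρ₀ ^ 2 +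
          2 * (R₁ * (E₂ * (R₁ + U₀) + E₁)) / ρ₀ ^ 2 + 2 * (U₀ * (E₂ * (R₁ + U₀) + E₁) ^ 2) / ρ₀ ^ 3 :=
        add_le_add (add_le_add (add_le_add t1 t2) t3) t4
    _ = _ := by ring

end Polar

end Summit.HubbardSuperconductivity.HubbardSuperconductivity.Theorems.C4a
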